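import Summits.BirchSwinnertonDyer.BirchSwinnertonDyer.Theorems.ByReductionTypeAtTwoRankOneSigmaHeightTateFormula
import HarnessLib

/-!
# Route `ByReductionTypeAtTwo`, crux `RankOneAtTwoBigImageOddLocal` (item stmt-BirchSwinnertonDyer-23715), line AN62, σ₀-LEMMA BLOCK
# (cell `bsd-f1-sign2`, planner seat `-an` g50; `--supports 23715`, helper; sequel of `…SigmaHeightTateFormula`):
# **LEVEL ONE (`‖x(Q)‖₂ = 4`), part 1: the residue law `num x ≡ 1 + 4a₂ (mod 8)`, `‖log₂ num x‖₂ = ¼ ⟺ a₂ odd`, and the locus is `‖x‖₂ ≥ 16`**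

HONEST FRAMING (D-0036/D-0054): THEOREMS ONLY (no definition, no named fact, no `sorry`, no instance).  `V/ℚ` `ℤ`-integral with `a₁ = 0`.
A point `Q = (x, y)` with `‖x‖₂ = 4` is at LEVEL ONE of the formal group at `2` — outside the local-conditions locus (§6bis: the locus is
`‖x‖₂ ≥ 16`).  Nothing here is a statement about `BSDp`; item 23715 stays OPEN; BSD is proved for no curve.

* §6 `norm_cast_num_sub_le_of_norm_eq_four` — **`num x ≡ 1 + 4a₂ (mod 8)` at `‖x‖₂ = 4`** (`a³ − b² + a₂a²d = d³(a₃y − a₄x − a₆)` has norm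
  `≤ ⅛`, `d = 4·odd`, `b² ≡ a² ≡ 1 (mod 8)`); `norm_padicLog_num_le_of_norm_eq_four` / `norm_padicLog_num_eq_quarter_iff`:
  `‖log₂ num x‖₂ ≤ ¼`, with equality iff `a₂` is odd (isometry of `log₂` on `1 + 4ℤ₂`).
* §6bis `sixteen_le_norm_of_satisfiesLocalConditions_two`: a point of the local-conditions locus at `2` has `‖x‖₂ ≥ 16`.
The sequel `…SigmaHeightLevelOneLaw` turns these into the level-one law for the η-height, given Néron's duplication numerator.

PLACEMENT: corollary-of-print ∘ kernel.  References: [cite: SilvermanAEC2009, III.2.3(d), VII.2.2] [cite: MazurSteinTate2006, §1 (1.1), §4]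
[cite: Iwasawa1972PadicL, §4.4].
-/

set_option autoImplicit false

noncomputable section

open scoped Classical

open PowerSeries WeierstrassCurve Literature Literature.NumberTheory.EllipticCurves

namespace Summit.BirchSwinnertonDyer.BirchSwinnertonDyer.Theorems

namespace NaiveSigmaLogAtTwo

/-! ### §6 Level one: `num x ≡ 1 + 4a₂ (mod 8)` -/

/-- For an odd integer `n`: `‖n² − 1‖₂ ≤ ⅛`. -/
theorem norm_sq_sub_one_le_of_odd {n : ℤ} (hn : Odd n) : ‖(n : ℚ_[2]) ^ 2 - 1‖ ≤ 8⁻¹ := by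
  have h8 := (Padic.norm_int_le_pow_iff_dvd (p := 2) (n ^ 2 - 1 ^ 2) 3).mpr
    (by have e := eight_dvd_sq_sub_sq_of_odd hn odd_one; norm_num at e ⊢; exact e)
  have e : ((n ^ 2 - 1 ^ 2 : ℤ) : ℚ_[2]) = (n : ℚ_[2]) ^ 2 - 1 := by push_cast; ring
  rw [e] at h8
  exact h8.trans (by norm_num)

/-- **`num x ≡ 1 + 4a₂ (mod 8)` at level one**: on a `ℤ`-integral model with `a₁ = 0`, a non-singular `(x, y)` with `‖x‖₂ = 4` has
`‖num x − 1 − 4a₂‖₂ ≤ ⅛`. [cite: SilvermanAEC2009, VII.2.2] -/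
theorem norm_cast_num_sub_le_of_norm_eq_four (V : WeierstrassCurve ℚ) [V.IsIntegral ℤ] {x y : ℚ} (h : V.toAffine.Nonsingular x y)
    (ha1 : V.a₁ = 0) (hx : ‖(x : ℚ_[2])‖ = 4) : ‖(x.num : ℚ_[2]) - 1 - 4 * (V.a₂ : ℚ_[2])‖ ≤ 8⁻¹ := by
  have hx1 : 1 < ‖(x : ℚ_[2])‖ := by rw [hx]; norm_num
  obtain ⟨hxo, hyo⟩ := odd_num_and_odd_num V h hx1
  have hsq := WeierstrassCurve.norm_div_sq_eq_inv_norm_of_one_lt_norm h hx1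
  set X : ℚ_[2] := (x : ℚ_[2]) with hXdef
  set Y : ℚ_[2] := (y : ℚ_[2]) with hYdef
  have hX0 : X ≠ 0 := fun e => by rw [e, norm_zero] at hx1; linarith
  have hY0 : Y ≠ 0 := by
    intro e
    rw [e, div_zero, norm_zero, zero_pow two_ne_zero] at hsq
    exact (inv_ne_zero (norm_ne_zero_iff.mpr hX0)) hsq.symm
  set a : ℚ_[2] := (x.num : ℚ_[2]) with hadef
  set b : ℚ_[2] := (y.num : ℚ_[2]) with hbdef
  set dX : ℚ_[2] := (x.den : ℚ_[2]) with hdXdef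
  set dY : ℚ_[2] := (y.den : ℚ_[2]) with hdYdef
  have hdX0 : dX ≠ 0 := by rw [hdXdef]; exact_mod_cast x.den_nz
  have hdY0 : dY ≠ 0 := by rw [hdYdef]; exact_mod_cast y.den_nz
  have hXnd : X = a / dX := by rw [hXdef, hadef, hdXdef]; exact_mod_cast (Rat.num_div_den x).symm
  have hYnd : Y = b / dY := by rw [hYdef, hbdef, hdYdef]; exact_mod_cast (Rat.num_div_den y).symm
  have hd32 : dX ^ 3 = dY ^ 2 := by rw [hdXdef, hdYdef]; exact_mod_cast den_pow_three_eq_den_sq V h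
  have hndX : ‖dX‖ = 4⁻¹ := by rw [hdXdef, norm_natCast_den_eq x, max_eq_right hx1.le]; rw [hx]
  have hY2 : ‖Y‖ ^ 2 = ‖X‖ ^ 3 := by
    rw [norm_div, div_pow] at hsq
    field_simp at hsq
    nlinarith [hsq, norm_nonneg X, norm_nonneg Y]
  have hnY : ‖Y‖ = 8 := by
    have h64 : ‖Y‖ ^ 2 = 64 := by rw [hY2, hx]; norm_num
    nlinarith [norm_nonneg Y, h64]
  have hA2 : ‖(V.a₂ : ℚ_[2])‖ ≤ 1 := (mem_localIntegers_iff 2 _).mp (V.a₂_mem_localIntegers 2)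
  have hA3 : ‖(V.a₃ : ℚ_[2])‖ ≤ 1 := (mem_localIntegers_iff 2 _).mp (V.a₃_mem_localIntegers 2)
  have hA4 : ‖(V.a₄ : ℚ_[2])‖ ≤ 1 := (mem_localIntegers_iff 2 _).mp (V.a₄_mem_localIntegers 2)
  have hA6 : ‖(V.a₆ : ℚ_[2])‖ ≤ 1 := (mem_localIntegers_iff 2 _).mp (V.a₆_mem_localIntegers 2)
  have heq : Y ^ 2 + (V.a₃ : ℚ_[2]) * Y = X ^ 3 + (V.a₂ : ℚ_[2]) * X ^ 2 + (V.a₄ : ℚ_[2]) * X + (V.a₆ : ℚ_[2]) := by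
    have e := (WeierstrassCurve.Affine.equation_iff x y).mp h.1
    have e' := congrArg (fun q : ℚ => (q : ℚ_[2])) e
    push_cast at e'
    have ea : ((V.toAffine.a₁ : ℚ) : ℚ_[2]) = 0 := by rw [show V.toAffine.a₁ = V.a₁ from rfl, ha1, Rat.cast_zero]
    rw [ea, zero_mul, zero_mul, add_zero] at e'
    exact e'
  have ha : a = X * dX := by rw [hXnd, div_mul_cancel₀ _ hdX0]
  have hb2 : b ^ 2 = Y ^ 2 * dX ^ 3 := by rw [hd32, hYnd, div_pow, div_mul_cancel₀ _ (pow_ne_zero 2 hdY0)]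
  -- `a³ − b² + a₂a²d = d³(a₃y − a₄x − a₆)`
  have hdiff : a ^ 3 - b ^ 2 + (V.a₂ : ℚ_[2]) * a ^ 2 * dX =
      dX ^ 3 * ((V.a₃ : ℚ_[2]) * Y - (V.a₄ : ℚ_[2]) * X - (V.a₆ : ℚ_[2])) := by
    rw [ha, hb2]; linear_combination (-(dX ^ 3)) * heq
  have hR : ‖(V.a₃ : ℚ_[2]) * Y - (V.a₄ : ℚ_[2]) * X - (V.a₆ : ℚ_[2])‖ ≤ 8 := by
    have n1 : ‖(V.a₃ : ℚ_[2]) * Y‖ ≤ 8 := by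
      rw [norm_mul, hnY]; calc ‖(V.a₃ : ℚ_[2])‖ * 8 ≤ 1 * 8 := by gcongr
        _ = 8 := one_mul _
    have n2 : ‖(V.a₄ : ℚ_[2]) * X‖ ≤ 8 := by
      rw [norm_mul, hx]; calc ‖(V.a₄ : ℚ_[2])‖ * 4 ≤ 1 * 4 := by gcongr
        _ ≤ 8 := by norm_num
    rw [show (V.a₃ : ℚ_[2]) * Y - (V.a₄ : ℚ_[2]) * X - (V.a₆ : ℚ_[2]) =
      (V.a₃ : ℚ_[2]) * Y + -((V.a₄ : ℚ_[2]) * X) + -(V.a₆ : ℚ_[2]) by ring]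
    refine (IsUltrametricDist.norm_add_le_max _ _).trans (max_le ?_ (by rw [norm_neg]; exact hA6.trans (by norm_num)))
    exact (IsUltrametricDist.norm_add_le_max _ _).trans (max_le n1 (by rw [norm_neg]; exact n2))
  have h1 : ‖a ^ 3 - b ^ 2 + (V.a₂ : ℚ_[2]) * a ^ 2 * dX‖ ≤ 8⁻¹ := by
    rw [hdiff, norm_mul, norm_pow, hndX]
    calc (4⁻¹ : ℝ) ^ 3 * ‖(V.a₃ : ℚ_[2]) * Y - (V.a₄ : ℚ_[2]) * X - (V.a₆ : ℚ_[2])‖ ≤ (4⁻¹ : ℝ) ^ 3 * 8 := by gcongr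
      _ = 8⁻¹ := by norm_num
  -- `d = 4δ` with `δ` odd: `‖d − 4‖ ≤ ⅛`
  have hd4 : ‖dX - 4‖ ≤ 8⁻¹ := by
    have hdvd : (2 : ℤ) ^ 2 ∣ (x.den : ℤ) := (Padic.norm_int_le_pow_iff_dvd (p := 2) (x.den : ℤ) 2).mp (by
      rw [Int.cast_natCast, ← hdXdef, hndX]; norm_num)
    obtain ⟨δ, hδ⟩ := hdvd
    have hδc : dX = 4 * (δ : ℚ_[2]) := by
      rw [hdXdef, show ((x.den : ℕ) : ℚ_[2]) = ((x.den : ℤ) : ℚ_[2]) by norm_cast, hδ]; push_cast; ring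
    have h4n : ‖(4 : ℚ_[2])‖ = 4⁻¹ := by
      rw [show (4 : ℚ_[2]) = 2 * 2 by norm_num, norm_mul, Rank2Observatory.padic_norm_two]; norm_num
    have hδ1 : ‖(δ : ℚ_[2])‖ = 1 := by
      have := hndX; rw [hδc, norm_mul, h4n] at this
      linarith
    have hδodd : Odd δ := by
      rw [← Int.not_even_iff_odd, even_iff_two_dvd]
      intro h2
      have := Padic.norm_intCast_lt_one_iff.mpr (by exact_mod_cast h2 : (2 : ℤ) ∣ δ)
      rw [hδ1] at this; exact lt_irrefl _ this
    have hδm : ‖(δ : ℚ_[2]) - 1‖ ≤ 2⁻¹ := by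
      have h2 := (Padic.norm_int_le_pow_iff_dvd (p := 2) (δ - 1) 1).mpr (by
        obtain ⟨k, hk⟩ := hδodd; exact ⟨k, by rw [hk]; ring⟩)
      push_cast at h2
      exact h2.trans (by norm_num)
    rw [hδc, show (4 : ℚ_[2]) * (δ : ℚ_[2]) - 4 = 4 * ((δ : ℚ_[2]) - 1) by ring, norm_mul, h4n]
    calc (4⁻¹ : ℝ) * ‖(δ : ℚ_[2]) - 1‖ ≤ 4⁻¹ * 2⁻¹ := by gcongr
      _ = 8⁻¹ := by norm_num
  -- `a² ≡ 1`, `b² ≡ 1 (mod 8)`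
  have ha2sq : ‖a ^ 2 - 1‖ ≤ 8⁻¹ := by rw [hadef]; exact norm_sq_sub_one_le_of_odd hxo
  have hb2sq : ‖b ^ 2 - 1‖ ≤ 8⁻¹ := by rw [hbdef]; exact norm_sq_sub_one_le_of_odd hyo
  -- `a₂a²d ≡ 4a₂ (mod 8)`
  have h2 : ‖(V.a₂ : ℚ_[2]) * a ^ 2 * dX - 4 * (V.a₂ : ℚ_[2])‖ ≤ 8⁻¹ := by
    rw [show (V.a₂ : ℚ_[2]) * a ^ 2 * dX - 4 * (V.a₂ : ℚ_[2]) =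
      (V.a₂ : ℚ_[2]) * ((a ^ 2 - 1) * dX) + (V.a₂ : ℚ_[2]) * (dX - 4) by ring]
    refine (IsUltrametricDist.norm_add_le_max _ _).trans (max_le ?_ ?_)
    · rw [norm_mul, norm_mul, hndX]
      calc ‖(V.a₂ : ℚ_[2])‖ * (‖a ^ 2 - 1‖ * 4⁻¹) ≤ 1 * (8⁻¹ * 4⁻¹) := by gcongr
        _ ≤ 8⁻¹ := by norm_num
    · rw [norm_mul]
      calc ‖(V.a₂ : ℚ_[2])‖ * ‖dX - 4‖ ≤ 1 * 8⁻¹ := by gcongr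
        _ = 8⁻¹ := one_mul _
  -- `a − a³ = a(1 − a²)`
  have h3 : ‖a - a ^ 3‖ ≤ 8⁻¹ := by
    rw [show a - a ^ 3 = -(a * (a ^ 2 - 1)) by ring, norm_neg, norm_mul]
    calc ‖a‖ * ‖a ^ 2 - 1‖ ≤ 1 * 8⁻¹ := by
          gcongr
          · rw [hadef]; exact Padic.norm_int_le_one _
      _ = 8⁻¹ := one_mul _
  have e : a - 1 - 4 * (V.a₂ : ℚ_[2]) = (a - a ^ 3) + (a ^ 3 - b ^ 2 + (V.a₂ : ℚ_[2]) * a ^ 2 * dX) + (b ^ 2 - 1) +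
      -((V.a₂ : ℚ_[2]) * a ^ 2 * dX - 4 * (V.a₂ : ℚ_[2])) + -(8 * (V.a₂ : ℚ_[2])) := by ring
  have h8a2 : ‖(8 : ℚ_[2]) * (V.a₂ : ℚ_[2])‖ ≤ 8⁻¹ := by
    rw [norm_mul, show (8 : ℚ_[2]) = 2 * 2 * 2 by norm_num, norm_mul, norm_mul, Rank2Observatory.padic_norm_two]
    calc (2⁻¹ : ℝ) * 2⁻¹ * 2⁻¹ * ‖(V.a₂ : ℚ_[2])‖ ≤ 2⁻¹ * 2⁻¹ * 2⁻¹ * 1 := by gcongr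
      _ = 8⁻¹ := by norm_num
  rw [e]
  refine (IsUltrametricDist.norm_add_le_max _ _).trans (max_le ?_ (by rw [norm_neg]; exact h8a2))
  refine (IsUltrametricDist.norm_add_le_max _ _).trans (max_le ?_ (by rw [norm_neg]; exact h2))
  refine (IsUltrametricDist.norm_add_le_max _ _).trans (max_le ?_ hb2sq)
  exact (IsUltrametricDist.norm_add_le_max _ _).trans (max_le h3 h1)

/-- At level one, **`‖log₂ num x‖₂ ≤ ¼`** (`num x ≡ 1 (mod 4)`, isometry of `log₂` on `1 + 4ℤ₂`). -/
theorem norm_padicLog_num_le_of_norm_eq_four (V : WeierstrassCurve ℚ) [V.IsIntegral ℤ] {x y : ℚ} (h : V.toAffine.Nonsingular x y)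
    (ha1 : V.a₁ = 0) (hx : ‖(x : ℚ_[2])‖ = 4) : ‖padicLog 2 (x.num : ℚ_[2])‖ ≤ 4⁻¹ := by
  have h8 := norm_cast_num_sub_le_of_norm_eq_four V h ha1 hx
  have hA2 : ‖(V.a₂ : ℚ_[2])‖ ≤ 1 := (mem_localIntegers_iff 2 _).mp (V.a₂_mem_localIntegers 2)
  have h4 : ‖(4 : ℚ_[2]) * (V.a₂ : ℚ_[2])‖ ≤ 4⁻¹ := by
    rw [norm_mul, show (4 : ℚ_[2]) = 2 * 2 by norm_num, norm_mul, Rank2Observatory.padic_norm_two]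
    calc (2⁻¹ : ℝ) * 2⁻¹ * ‖(V.a₂ : ℚ_[2])‖ ≤ 2⁻¹ * 2⁻¹ * 1 := by gcongr
      _ = 4⁻¹ := by norm_num
  have hn : ‖(x.num : ℚ_[2]) - 1‖ ≤ 4⁻¹ := by
    rw [show (x.num : ℚ_[2]) - 1 = ((x.num : ℚ_[2]) - 1 - 4 * (V.a₂ : ℚ_[2])) + 4 * (V.a₂ : ℚ_[2]) by ring]
    exact (IsUltrametricDist.norm_add_le_max _ _).trans (max_le (h8.trans (by norm_num)) h4)
  rw [norm_padicLog_eq_of_norm_sub_one_le hn]; exact hn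

/-- At level one, **`‖log₂ num x‖₂ = ¼ ⟺ a₂` is odd** (`num x ≡ 1 + 4a₂ (mod 8)`). -/
theorem norm_padicLog_num_eq_quarter_iff (V : WeierstrassCurve ℚ) [V.IsIntegral ℤ] {x y : ℚ} (h : V.toAffine.Nonsingular x y)
    (ha1 : V.a₁ = 0) (hx : ‖(x : ℚ_[2])‖ = 4) (a2 : ℤ) (ha2 : V.a₂ = a2) :
    ‖padicLog 2 (x.num : ℚ_[2])‖ = 4⁻¹ ↔ Odd a2 := by
  have h8 := norm_cast_num_sub_le_of_norm_eq_four V h ha1 hx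
  rw [ha2, Rat.cast_intCast] at h8
  have h4n : ‖(4 : ℚ_[2])‖ = 4⁻¹ := by
    rw [show (4 : ℚ_[2]) = 2 * 2 by norm_num, norm_mul, Rank2Observatory.padic_norm_two]; norm_num
  have hn : ‖(x.num : ℚ_[2]) - 1‖ ≤ 4⁻¹ := by
    rw [show (x.num : ℚ_[2]) - 1 = ((x.num : ℚ_[2]) - 1 - 4 * (a2 : ℚ_[2])) + 4 * (a2 : ℚ_[2]) by ring]
    refine (IsUltrametricDist.norm_add_le_max _ _).trans (max_le (h8.trans (by norm_num)) ?_)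
    rw [norm_mul, h4n]
    calc (4⁻¹ : ℝ) * ‖(a2 : ℚ_[2])‖ ≤ 4⁻¹ * 1 := by gcongr; exact Padic.norm_int_le_one _
      _ = 4⁻¹ := mul_one _
  rw [norm_padicLog_eq_of_norm_sub_one_le hn]
  constructor
  · intro hq
    rw [← Int.not_even_iff_odd, even_iff_two_dvd]
    intro h2
    have hs : ‖(4 : ℚ_[2]) * (a2 : ℚ_[2])‖ ≤ 8⁻¹ := by
      rw [norm_mul, h4n]
      have := Padic.norm_intCast_lt_one_iff.mpr (by exact_mod_cast h2 : (2 : ℤ) ∣ a2)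
      -- norms of integers are powers of two: `< 1 ⟹ ≤ ½`
      have hle : ‖(a2 : ℚ_[2])‖ ≤ 2⁻¹ := by
        have h1 := (Padic.norm_int_le_pow_iff_dvd (p := 2) a2 1).mpr (by simpa using (by exact_mod_cast h2 : (2 : ℤ) ∣ a2))
        simpa using h1
      calc (4⁻¹ : ℝ) * ‖(a2 : ℚ_[2])‖ ≤ 4⁻¹ * 2⁻¹ := by gcongr
        _ = 8⁻¹ := by norm_num
    have : ‖(x.num : ℚ_[2]) - 1‖ ≤ 8⁻¹ := by
      rw [show (x.num : ℚ_[2]) - 1 = ((x.num : ℚ_[2]) - 1 - 4 * (a2 : ℚ_[2])) + 4 * (a2 : ℚ_[2]) by ring]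
      exact (IsUltrametricDist.norm_add_le_max _ _).trans (max_le h8 hs)
    rw [hq] at this; norm_num at this
  · intro hodd
    have h4a : ‖(4 : ℚ_[2]) * (a2 : ℚ_[2])‖ = 4⁻¹ := by
      rw [norm_mul, h4n, DepletionAtTwo.norm_intCast_eq_one_of_odd hodd, mul_one]
    have hne : ‖(x.num : ℚ_[2]) - 1 - 4 * (a2 : ℚ_[2])‖ ≠ ‖(4 : ℚ_[2]) * (a2 : ℚ_[2])‖ := by
      rw [h4a]; exact ne_of_lt (lt_of_le_of_lt h8 (by norm_num))
    rw [show (x.num : ℚ_[2]) - 1 = ((x.num : ℚ_[2]) - 1 - 4 * (a2 : ℚ_[2])) + 4 * (a2 : ℚ_[2]) by ring,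
      Padic.add_eq_max_of_ne hne, h4a]
    exact max_eq_right (h8.trans (by norm_num))

/-! ### §6bis The locus at `2` is `‖x‖₂ ≥ 16` -/

/-- The local-conditions locus at `2` consists of points with **`‖x‖₂ ≥ 16`** (`InSigmaDisc 2 (−x/y)` is `‖x/y‖₂ < ½`, and `‖x/y‖₂² = ‖x‖₂⁻¹`
is a power of `4`). -/
theorem sixteen_le_norm_of_satisfiesLocalConditions_two (V : WeierstrassCurve ℚ) [V.IsIntegral ℤ] {x y : ℚ}
    (h : V.toAffine.Nonsingular x y) (hP : V.SatisfiesLocalConditions 2 (.some x y h)) : (16 : ℝ) ≤ ‖(x : ℚ_[2])‖ := by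
  have hx1 := hP.1
  have hz := norm_lt_half_of_inSigmaDisc_two hP.2.1
  have hsq := WeierstrassCurve.norm_div_sq_eq_inv_norm_of_one_lt_norm h hx1
  rw [← norm_neg, ← neg_div] at hsq
  have hX0 : (x : ℚ_[2]) ≠ 0 := fun e => by rw [e, norm_zero] at hx1; linarith
  set z : ℚ_[2] := -(x : ℚ_[2]) / y
  have hz0 : z ≠ 0 := fun e => by
    rw [e, norm_zero, zero_pow two_ne_zero] at hsq; exact (inv_ne_zero (norm_ne_zero_iff.mpr hX0)) hsq.symm
  have hz4 : ‖z‖ ≤ 4⁻¹ := by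
    rw [Padic.norm_eq_zpow_neg_valuation hz0] at hz ⊢
    have hv : -z.valuation ≤ -(2 : ℤ) := by
      by_contra hgt
      rw [not_le] at hgt
      have := zpow_le_zpow_right₀ (by norm_num : (1 : ℝ) ≤ 2) (show -(1 : ℤ) ≤ -z.valuation by omega)
      exact absurd (lt_of_le_of_lt this hz) (by norm_num)
    exact (zpow_le_zpow_right₀ (by norm_num : (1 : ℝ) ≤ 2) hv).trans (by norm_num)
  have hx' : ‖(x : ℚ_[2])‖ = (‖z‖ ^ 2)⁻¹ := by rw [hsq, inv_inv]
  rw [hx']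
  have hzsq : ‖z‖ ^ 2 ≤ 16⁻¹ := by nlinarith [hz4, norm_nonneg z]
  have hzpos : 0 < ‖z‖ ^ 2 := by positivity
  calc (16 : ℝ) = (16⁻¹)⁻¹ := by norm_num
    _ ≤ (‖z‖ ^ 2)⁻¹ := inv_anti₀ hzpos hzsq

end NaiveSigmaLogAtTwo

end Summit.BirchSwinnertonDyer.BirchSwinnertonDyer.Theorems
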